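import Summits.Schanuel.Schanuel.Theorems.SoloInformedAdditiveCoincidenceRigidity

/-!
# Robust 3-AP rigidity: few violated progressions force an affine law on the even part

Soloist file (informed mode, seat `solo-Schanuel-informed`, s182).  Companion of
`SoloInformedAdditiveCoincidenceRigidity` (THEOREM C: if all but `≤ 10⁻⁴ K³` additive
coincidences `φ(a+u) − φ(a) = φ(b+u) − φ(b)` inside a set `S ⊆ [1, K]` missing `≤ 1 %` of
`[1, K]` hold, then `φ` is affine off a sparse set).  Here the input is weaker in kind:
only the THREE-TERM PROGRESSIONS are controlled.

**THEOREM C₃ (even part).**  Let `G` be an abelian group, `K ≥ 2000`, `S ⊆ ℕ` with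
`40000 · #([1,K] ∖ S) ≤ K`, `φ : ℕ → G`, and let `V` contain every VIOLATED PROGRESSION:
every `(x, m, z)` with `x, m, z ∈ S`, `x + z = 2m` and `φ x + φ z ≠ 2 • φ m`.  If
`200000 · #V ≤ K²`, then there are `γ, μ ∈ G` and a set `Y` of `≥ 0.49 K` naturals `y` with
`2y ∈ S` and `φ (2y) = γ + y • μ`
(`soloAR_even_affine_of_few_violated_progressions`).

Proof (reduction to Theorem C on the halved set).  Put `K₂ = ⌊K/2⌋`,
`S₂ = {y ∈ [1, K₂] : 2y ∈ S}`, `ψ(y) = φ(2y)`.  An additive coincidence `((a, b), w)` of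
`S₂` is CERTIFIED by the common midpoint `m = a + b + w ∈ [1, K]`: if `m ∈ S` and the two
progressions `(2a, m, 2(b+w))`, `(2b, m, 2(a+w))` are exact then
`φ(2a) + φ(2b+2w) = 2•φ(m) = φ(2b) + φ(2a+2w)`, i.e. `ψ(a+w) − ψ(a) = ψ(b+w) − ψ(b)`.  Hence a
violated coincidence has `m ∉ S` (at most `#([1,K]∖S) · K₂²` of them: `(m, a, b)` determines
`w`) or one of the two progressions in `V` (at most `#V · K₂` each: the progression and the
remaining free endpoint determine the coincidence), so
`#V₂ ≤ #([1,K]∖S) K₂² + 2 #V K₂ ≤ 10⁻⁴ K₂³` under the stated hypotheses, while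
`[1, K₂] ∖ S₂` injects into `[1, K] ∖ S` (`y ↦ 2y`).  Theorem C then gives `γ, μ` and an
exceptional set `X` with `K₂² #X ≤ 110 #V₂`, and `Y = S₂ ∖ X` has
`#Y ≥ K₂ − K/40000 − 0.011 K₂ ≥ 0.49 K`.

The odd part of `S` is deliberately ignored: the seat's application (structured roots for
Roy's additive data, file `SoloInformedAE3StructuredRoots`) only needs a positive density of
points on ONE affine progression.  Purely combinatorial; Mathlib + the companion file; no
definitions, no literature hypotheses, axioms the standard three.  It serves the seat's
partial result AE₃-1 on the toy node `RoyAdditiveDirichletExponent` ([cite: Roy2010, Thm 1.1])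
and says nothing about `Literature.Periods.SchanuelConjecture` (verdict unchanged: no path).
-/

namespace Summit.Schanuel.Schanuel.Theorems

open Finset

/-- **THEOREM C₃ (even part): robust 3-AP rigidity.**  `K ≥ 2000`, `S` missing at most
`K / 40000` points of `[1, K]`, `V ⊇` all violated progressions `(x, m, z)` of `S`
(`x + z = 2m`, `φ x + φ z ≠ 2 • φ m`) with `200000 · #V ≤ K²`.  Then `φ(2y) = γ + y • μ` for
all `y` in a set `Y` with `2Y ⊆ S` and `100 · #Y ≥ 49 K`. -/
theorem soloAR_even_affine_of_few_violated_progressions {G : Type*} [AddCommGroup G] {K : ℕ}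
    (hK : 2000 ≤ K) {S : Finset ℕ} (hE : 40000 * #(Icc 1 K \ S) ≤ K)
    (φ : ℕ → G) {V : Finset (ℕ × ℕ × ℕ)}
    (hV : ∀ x ∈ S, ∀ m ∈ S, ∀ z ∈ S, x + z = 2 * m → φ x + φ z ≠ 2 • φ m → (x, m, z) ∈ V)
    (hVK : 200000 * #V ≤ K ^ 2) :
    ∃ γ μ : G, ∃ Y : Finset ℕ, 49 * K ≤ 100 * #Y ∧
      ∀ y ∈ Y, 2 * y ∈ S ∧ φ (2 * y) = γ + y • μ := by
  classical
  -- the halved data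
  obtain ⟨K₂, hK₂⟩ : ∃ K₂ : ℕ, K₂ = K / 2 := ⟨_, rfl⟩
  have hKlo : 2 * K₂ ≤ K := by omega
  have hKhi : K ≤ 2 * K₂ + 1 := by omega
  have hK₂ : 1000 ≤ K₂ := by omega
  obtain ⟨E, hEdef⟩ : ∃ E : Finset ℕ, E = Icc 1 K \ S := ⟨_, rfl⟩
  rw [← hEdef] at hE
  obtain ⟨S₂, hS₂def⟩ : ∃ S₂ : Finset ℕ, S₂ = (Icc 1 K₂).filter (fun y => 2 * y ∈ S) :=
    ⟨_, rfl⟩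
  have memS₂ : ∀ {y}, y ∈ S₂ ↔ (1 ≤ y ∧ y ≤ K₂) ∧ 2 * y ∈ S := by
    intro y; rw [hS₂def, Finset.mem_filter, Finset.mem_Icc]
  have hS₂ : S₂ ⊆ Icc 1 K₂ := by rw [hS₂def]; exact Finset.filter_subset _ _
  obtain ⟨ψ, hψ⟩ : ∃ ψ : ℕ → G, ψ = fun y => φ (2 * y) := ⟨_, rfl⟩
  -- `[1, K₂] \ S₂` injects into `E` by doubling
  have hE₂card : #(Icc 1 K₂ \ S₂) ≤ #E := by
    refine Finset.card_le_card_of_injOn (fun y => 2 * y) (fun y hy => ?_)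
      (fun y _ y' _ h => by simpa using h)
    rw [Finset.mem_coe, Finset.mem_sdiff, Finset.mem_Icc] at hy
    show 2 * y ∈ (E : Set ℕ)
    rw [Finset.mem_coe, hEdef, Finset.mem_sdiff, Finset.mem_Icc]
    refine ⟨⟨by omega, by omega⟩, fun h2y => hy.2 (memS₂.mpr ⟨hy.1, h2y⟩)⟩
  have hE₂ : 100 * #(Icc 1 K₂ \ S₂) ≤ K₂ := by
    have := hE₂card; omega
  -- the violated coincidences of the halved data
  obtain ⟨V₂, hV₂def⟩ : ∃ V₂ : Finset ((ℕ × ℕ) × ℕ), V₂ =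
      ((Icc 1 K₂ ×ˢ Icc 1 K₂) ×ˢ Finset.range (K₂ + 1)).filter
        (fun x => x.1.1 ∈ S₂ ∧ x.1.2 ∈ S₂ ∧ x.1.1 + x.2 ∈ S₂ ∧ x.1.2 + x.2 ∈ S₂ ∧
          ψ (x.1.1 + x.2) - ψ x.1.1 ≠ ψ (x.1.2 + x.2) - ψ x.1.2) := ⟨_, rfl⟩
  have hVmem : ∀ a ∈ S₂, ∀ b ∈ S₂, ∀ u : ℕ, a + u ∈ S₂ → b + u ∈ S₂ →
      ψ (a + u) - ψ a ≠ ψ (b + u) - ψ b → ((a, b), u) ∈ V₂ := by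
    intro a ha b hb u hau hbu hne
    rw [hV₂def, Finset.mem_filter]
    refine ⟨?_, ha, hb, hau, hbu, hne⟩
    have ha' := (memS₂.mp ha).1
    have hb' := (memS₂.mp hb).1
    have hau' := (memS₂.mp hau).1
    simp only [Finset.mem_product, Finset.mem_range, Finset.mem_Icc]
    exact ⟨⟨⟨ha'.1, ha'.2⟩, hb'.1, hb'.2⟩, by omega⟩
  have hV₂mem : ∀ x ∈ V₂, x.1.1 ∈ S₂ ∧ x.1.2 ∈ S₂ ∧ x.1.1 + x.2 ∈ S₂ ∧ x.1.2 + x.2 ∈ S₂ ∧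
      ψ (x.1.1 + x.2) - ψ x.1.1 ≠ ψ (x.1.2 + x.2) - ψ x.1.2 := by
    intro x hx
    rw [hV₂def, Finset.mem_filter] at hx
    exact hx.2
  -- certification by the common midpoint: a violated coincidence has a reason
  have hreason : ∀ x ∈ V₂, x.1.1 + x.1.2 + x.2 ∈ E ∨
      (2 * x.1.1, x.1.1 + x.1.2 + x.2, 2 * (x.1.2 + x.2)) ∈ V ∨
      (2 * x.1.2, x.1.1 + x.1.2 + x.2, 2 * (x.1.1 + x.2)) ∈ V := by
    intro x hx
    obtain ⟨ha, hb, hau, hbu, hne⟩ := hV₂mem x hx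
    obtain ⟨⟨ha1, haK⟩, haS⟩ := memS₂.mp ha
    obtain ⟨⟨hb1, hbK⟩, hbS⟩ := memS₂.mp hb
    obtain ⟨⟨-, hauK⟩, hauS⟩ := memS₂.mp hau
    obtain ⟨⟨-, hbuK⟩, hbuS⟩ := memS₂.mp hbu
    by_cases hm : x.1.1 + x.1.2 + x.2 ∈ E
    · exact Or.inl hm
    by_cases hv1 : (2 * x.1.1, x.1.1 + x.1.2 + x.2, 2 * (x.1.2 + x.2)) ∈ V
    · exact Or.inr (Or.inl hv1)
    by_cases hv2 : (2 * x.1.2, x.1.1 + x.1.2 + x.2, 2 * (x.1.1 + x.2)) ∈ V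
    · exact Or.inr (Or.inr hv2)
    exfalso
    have hmS : x.1.1 + x.1.2 + x.2 ∈ S := by
      by_contra hmS
      exact hm (by rw [hEdef, Finset.mem_sdiff, Finset.mem_Icc]; exact ⟨⟨by omega, by omega⟩, hmS⟩)
    have e1 : φ (2 * x.1.1) + φ (2 * (x.1.2 + x.2)) = 2 • φ (x.1.1 + x.1.2 + x.2) := by
      by_contra h
      exact hv1 (hV _ haS _ hmS _ hbuS (by ring) h)
    have e2 : φ (2 * x.1.2) + φ (2 * (x.1.1 + x.2)) = 2 • φ (x.1.1 + x.1.2 + x.2) := by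
      by_contra h
      exact hv2 (hV _ hbS _ hmS _ hauS (by ring) h)
    apply hne
    simp only [hψ]
    rw [sub_eq_sub_iff_add_eq_add, add_comm (φ (2 * (x.1.1 + x.2))), e2, ← e1, add_comm]
  -- counting the reasons
  have hcount : #V₂ ≤ #E * (K₂ * K₂) + (#V * K₂ + #V * K₂) := by
    have hIcc : #(Icc 1 K₂) = K₂ := by rw [Nat.card_Icc]; omega
    have hA : #(V₂.filter (fun x => x.1.1 + x.1.2 + x.2 ∈ E)) ≤ #E * (K₂ * K₂) := by
      rw [← hIcc, ← Finset.card_product, ← Finset.card_product]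
      refine Finset.card_le_card_of_injOn (fun x => (x.1.1 + x.1.2 + x.2, (x.1.1, x.1.2)))
        (fun x hx => ?_) (fun x hx x' hx' h => ?_)
      · rw [Finset.mem_coe, Finset.mem_filter] at hx
        obtain ⟨ha, hb, -⟩ := hV₂mem x hx.1
        rw [Finset.mem_coe, Finset.mem_product, Finset.mem_product]
        exact ⟨hx.2, hS₂ ha, hS₂ hb⟩
      · simp only [Prod.mk.injEq] at h
        obtain ⟨h1, h2, h3⟩ := h
        exact Prod.ext (Prod.ext h2 h3) (by omega)
    have hB : ∀ W : Finset ((ℕ × ℕ) × ℕ), W ⊆ V₂ →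
        (∀ x ∈ W, (2 * x.1.1, x.1.1 + x.1.2 + x.2, 2 * (x.1.2 + x.2)) ∈ V) →
        #W ≤ #V * K₂ := by
      intro W hW hWV
      rw [← hIcc, ← Finset.card_product]
      refine Finset.card_le_card_of_injOn
        (fun x => ((2 * x.1.1, x.1.1 + x.1.2 + x.2, 2 * (x.1.2 + x.2)), x.1.2))
        (fun x hx => ?_) (fun x hx x' hx' h => ?_)
      · rw [Finset.mem_coe] at hx
        obtain ⟨-, hb, -⟩ := hV₂mem x (hW hx)
        rw [Finset.mem_coe, Finset.mem_product]
        exact ⟨hWV x hx, hS₂ hb⟩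
      · simp only [Prod.mk.injEq] at h
        obtain ⟨⟨h1, h2, -⟩, h3⟩ := h
        exact Prod.ext (Prod.ext (by omega) h3) (by omega)
    have hB₁ := hB (V₂.filter (fun x => (2 * x.1.1, x.1.1 + x.1.2 + x.2, 2 * (x.1.2 + x.2)) ∈ V))
      (Finset.filter_subset _ _) (fun x hx => (Finset.mem_filter.mp hx).2)
    -- the third family, through the swap `(a, b) ↦ (b, a)` (which preserves `V₂`)
    have hswap : ∀ x ∈ V₂, ((x.1.2, x.1.1), x.2) ∈ V₂ := by
      intro x hx
      obtain ⟨ha, hb, hau, hbu, hne⟩ := hV₂mem x hx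
      exact hVmem _ hb _ ha _ hbu hau hne.symm
    have hB₂ : #(V₂.filter (fun x => (2 * x.1.2, x.1.1 + x.1.2 + x.2, 2 * (x.1.1 + x.2)) ∈ V))
        ≤ #V * K₂ := by
      have himg : (V₂.filter
          (fun x => (2 * x.1.2, x.1.1 + x.1.2 + x.2, 2 * (x.1.1 + x.2)) ∈ V)).image
            (fun x : (ℕ × ℕ) × ℕ => ((x.1.2, x.1.1), x.2)) ⊆
          V₂.filter (fun x => (2 * x.1.1, x.1.1 + x.1.2 + x.2, 2 * (x.1.2 + x.2)) ∈ V) := by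
        intro y hy
        obtain ⟨x, hx, rfl⟩ := Finset.mem_image.mp hy
        rw [Finset.mem_filter] at hx ⊢
        refine ⟨hswap x hx.1, ?_⟩
        have : x.1.2 + x.1.1 + x.2 = x.1.1 + x.1.2 + x.2 := by ring
        simp only [this]
        exact hx.2
      have hinj : Function.Injective (fun x : (ℕ × ℕ) × ℕ => ((x.1.2, x.1.1), x.2)) := by
        rintro ⟨⟨a, b⟩, u⟩ ⟨⟨a', b'⟩, u'⟩ h
        simp only [Prod.mk.injEq] at h
        obtain ⟨⟨h1, h2⟩, h3⟩ := h
        subst h1; subst h2; subst h3; rfl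
      calc #(V₂.filter (fun x => (2 * x.1.2, x.1.1 + x.1.2 + x.2, 2 * (x.1.1 + x.2)) ∈ V))
          = #((V₂.filter
              (fun x => (2 * x.1.2, x.1.1 + x.1.2 + x.2, 2 * (x.1.1 + x.2)) ∈ V)).image
              (fun x : (ℕ × ℕ) × ℕ => ((x.1.2, x.1.1), x.2))) :=
            (Finset.card_image_of_injective _ hinj).symm
        _ ≤ _ := Finset.card_le_card himg
        _ ≤ #V * K₂ := hB₁
    have hsub : V₂ ⊆ V₂.filter (fun x => x.1.1 + x.1.2 + x.2 ∈ E) ∪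
        (V₂.filter (fun x => (2 * x.1.1, x.1.1 + x.1.2 + x.2, 2 * (x.1.2 + x.2)) ∈ V) ∪
          V₂.filter (fun x => (2 * x.1.2, x.1.1 + x.1.2 + x.2, 2 * (x.1.1 + x.2)) ∈ V)) := by
      intro x hx
      rcases hreason x hx with h | h | h
      · exact Finset.mem_union_left _ (Finset.mem_filter.mpr ⟨hx, h⟩)
      · exact Finset.mem_union_right _ (Finset.mem_union_left _ (Finset.mem_filter.mpr ⟨hx, h⟩))
      · exact Finset.mem_union_right _ (Finset.mem_union_right _ (Finset.mem_filter.mpr ⟨hx, h⟩))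
    calc #V₂ ≤ _ := Finset.card_le_card hsub
      _ ≤ _ := Finset.card_union_le _ _
      _ ≤ #E * (K₂ * K₂) + (#V * K₂ + #V * K₂) :=
          add_le_add hA ((Finset.card_union_le _ _).trans (add_le_add hB₁ hB₂))
  -- the numerical budget of Theorem C on the halved data
  have h1 : 20000 * #E ≤ K₂ := by omega
  have h2 : 40000 * #V ≤ K₂ * K₂ := by
    have hsq : K ^ 2 ≤ (2 * K₂ + 1) ^ 2 := Nat.pow_le_pow_left hKhi 2
    have h4 : 4 * K₂ + 1 ≤ K₂ * K₂ := by nlinarith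
    nlinarith
  have hV₂K : 10000 * #V₂ ≤ K₂ ^ 3 := by
    have key : 2 * (10000 * #V₂) ≤ 2 * K₂ ^ 3 :=
      calc 2 * (10000 * #V₂) ≤ 2 * (10000 * (#E * (K₂ * K₂) + (#V * K₂ + #V * K₂))) := by
            gcongr
        _ = 20000 * #E * (K₂ * K₂) + 40000 * #V * K₂ := by ring
        _ ≤ K₂ * (K₂ * K₂) + K₂ * K₂ * K₂ :=
            add_le_add (Nat.mul_le_mul_right _ h1) (Nat.mul_le_mul_right _ h2)
        _ = 2 * K₂ ^ 3 := by ring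
    exact Nat.le_of_mul_le_mul_left key (by norm_num)
  -- Theorem C
  obtain ⟨γ, μ, X, hXcard, haff⟩ :=
    soloAC_affine_off_sparse_of_few_violations hK₂ hS₂ hE₂ ψ hVmem hV₂K
  have hX : 10000 * #X ≤ 110 * K₂ := by
    have h3 : K₂ ^ 2 * (10000 * #X) ≤ K₂ ^ 2 * (110 * K₂) :=
      calc K₂ ^ 2 * (10000 * #X) = 10000 * (K₂ ^ 2 * #X) := by ring
        _ ≤ 10000 * (110 * #V₂) := by gcongr
        _ = 110 * (10000 * #V₂) := by ring
        _ ≤ 110 * K₂ ^ 3 := by gcongr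
        _ = K₂ ^ 2 * (110 * K₂) := by ring
    exact Nat.le_of_mul_le_mul_left h3 (by positivity)
  -- the good set `Y = S₂ \ X`
  refine ⟨γ, μ, S₂.filter (fun y => y ∉ X), ?_, fun y hy => ?_⟩
  · have c1 : #(Icc 1 K₂ \ S₂) + #S₂ = K₂ := by
      rw [Finset.card_sdiff_add_card_eq_card hS₂, Nat.card_Icc]; omega
    have c2 : #(S₂.filter (fun y => y ∈ X)) + #(S₂.filter (fun y => y ∉ X)) = #S₂ :=
      Finset.card_filter_add_card_filter_not (fun y => y ∈ X)
    have c3 : #(S₂.filter (fun y => y ∈ X)) ≤ #X :=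
      Finset.card_le_card (fun y hy => (Finset.mem_filter.mp hy).2)
    omega
  · obtain ⟨hyS, hyX⟩ := Finset.mem_filter.mp hy
    refine ⟨(memS₂.mp hyS).2, ?_⟩
    have h := haff y hyS hyX
    simpa only [hψ] using h

end Summit.Schanuel.Schanuel.Theorems
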